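import Mathlib.NumberTheory.Cyclotomic.Basic
import Literature.NumberTheory.EllipticCurves.Wuthrich2014.ReducibleDivisibilityCyclotomicPrime
import Literature.NumberTheory.EllipticCurves.Wuthrich2014.SurjectiveNonsplitMultiplicativeDivisibilityCyclotomicThree
import Literature.NumberTheory.EllipticCurves.Wuthrich2014.SurjectiveSplitMultiplicativeDivisibilityCyclotomicThree
import Literature.NumberTheory.EllipticCurves.PAdicLFunctionPlusMult
import HarnessLib

/-!
# Kato's divisibility at a MULTIPLICATIVE odd prime `p` for curves with SURJECTIVE `ρ_{E,p^∞}`,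
# read over `K = ℚ(ζ_p)`, all `p − 1` branches (Wuthrich 2014, Thm. 3 / Cor. 19, "proven by Kato";
# two named facts): `char_{Λ(Γ)} X(E/ℚ(ζ_{p^∞})) ∋ u·∏_{i<p−1} L_p(E,ω^i,T)` (non-split),
# `T·char_{Λ(Γ)} X(E/ℚ(ζ_{p^∞})) ∋ u·∏_{i<p−1} L_p(E,ω^i,T)` (split)

Source, as PUBLISHED: C. Wuthrich, *On the integrality of modular symbols and Kato's Euler system
for elliptic curves*, Doc. Math. 19 (2014) 381–402 [Wuthrich2014]. §1 (journal p. 383, publisher PDF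
= EMS Press article file 26230, page text held by the cell at
`run/shared/lean/b2b/bsd-rank1-residual/b2b-bsdres-lit/g8/wuthrich2014/publisher_ems26230/p0003.txt`,
lines 2–25; literature-seat private key `paper:url-8fdc00c72d68`): "Another consequence of Theorem 1
concerns the main conjecture in Iwasawa theory for elliptic curves. **We formulate it here for the full
cyclotomic `ℤ_p^×`-extension.** Theorem 3. Let `E` be an elliptic curve and `p` an odd prime of
semi-stable reduction. Assume that `E[p]` is reducible as a Galois module over `ℚ`. Then the
characteristic series of the dual of the Selmer group over the cyclotomic extension `ℚ(ζ_{p^∞})`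
divides the ideal generated by the `p`-adic `L`-function `L_p(E)` in the Iwasawa algebra
`Λ = ℤ_p⟦Gal(ℚ(ζ_{p^∞})/ℚ)⟧`. Note that our assumptions in the theorem imply that the reduction of
`E` at `p` is ordinary in the sense that `E` has either good ordinary or multiplicative reduction,
because `E[p]` is irreducible when `E` has supersingular reduction, see Proposition 12 in [22]. In
the case when `E` has split multiplicative reduction, we can strengthen our theorem, see Theorem 16.
**This theorem was proven by Kato in [10] in the case that the reduction is ordinary and the
representation on the Tate module was surjective.**" (p0003.txt L19–L25 for the two "ordinary"
sentences; the hub's older rendering `paper:doi-10-4171-dm-450` is the AUTHOR'S VERSION of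
2013-04-23, whose p. 383 reads "proven by Kato in [8] in the case that the representation on the Tate
module was surjective" WITHOUT the "ordinary" clauses — cell literature seat gen 8, same folder,
`README.md` finding 3; this locator answers the referee's nit
`additive-p4-SurjMult-ordinary-parenthetical-unverified`, R116.6); §6 Cor. 19 (p. 398, publisher
text p0018.txt L63–L64: "If `E/ℚ` is a semi-stable elliptic curve and `p` an odd prime where `E` has
ordinary reduction") and its proof (p. 399): "If `E/ℚ` is a semi-stable elliptic curve and `p` an odd
prime where `E` has ordinary reduction, then `char_Λ X(E)`, or `I char_Λ X(E)` in the split multiplicative case,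
divides the ideal generated by `L_p(E)`. Proof. By a theorem of Serre […] the image of `ρ̄_p` is either
the whole of `GL₂(𝔽_p)` or it is contained in a Borel subgroup. In the latter case the representation
`ρ̄_p` is reducible and in the first case the representation `ρ_p : G_ℚ → Aut(T_p E)` is surjective by
another result of Serre unless `p = 3`. […]" — i.e. the FIRST CASE of the printed proof derives the
conclusion (with the factor `I` in the split case) from the surjectivity of `ρ_p` on `T_p E` alone,
at every odd `p`; Thm. 16 (p. 397, the `I`-clause: "`I` is the kernel of the homomorphism `Λ → ℤ_p`
that sends all elements of [the group] to `1`"); §5 (p. 397): `X(E)` = the dual of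
`lim_n Sel(E/ℚ(ζ_{p^n}))`, "a finitely generated `Λ`-module … `Λ`-torsion … in general in our
situation; see [Kobayashi 2006] for the split multiplicative case"; §3 (p. 390): `Λ = ℤ_p⟦G⟧`,
"`M = ⊕_{i=0}^{p−2} M_i` where `Δ` acts on `M_i` by the `i`-th power of the Teichmüller character";
§3.2 (p. 394): the Coleman map at a non-split multiplicative prime "is injective and has finite
cokernel", at a split one "injective [with] image with finite index inside `I`" (Kobayashi 2006
Thm. 4.1); Cor. 18 (p. 398): `L_p(E) ∈ Λ` for semi-stable `p > 2`. Torsion over the abelian base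
`ℚ(ζ_p)`: Greenberg, LNM 1716 Thm. 1.5 (Kato–Rohrlich), PDF p. 61. Behind the attribution: Kato,
Astérisque 295 (2004) Thm. 12.5 (4) under (12.5.2) (image of `Gal(ℚ̄/ℚ(ζ_{p^∞}))` contains
`SL₂(ℤ_p)`, implied by surjectivity of `ρ_{E,p^∞}` via `det = χ_p`); NOT Thm. 17.4, whose §17.1
requires `p ∤ N`.

TWO NAMED FACTS (`def … : Prop`, nothing asserted, D-0014/D-0026): "Kato's theorem as attributed in
Wuthrich Thm. 3 / Cor. 19 (first case of the proof)", MULTIPLICATIVE clauses — non-split, and split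
with the factor `I` — for an arbitrary odd prime `p` over the `ℤ_p^×`-extension, read over
`K = ℚ(ζ_p)` with ALL `p − 1` branches: the `p`-general forms announced as `TODO(general form)` in
the `p = 3` siblings `kato_charIdeal_dvd_nonsplitMultiplicative_cyclotomicThree_of_surjective`
(p217668; registry A105, flags `Wu14-surj-attribution` + `Wu14-Thm16-p3-branch-split`) and
`kato_charIdeal_dvd_splitMultiplicative_cyclotomicThree_of_surjective` (p218980; A108), and the
multiplicative siblings of `Kato2004.charIdeal_dvd_padicLFunction_cyclotomicPrime_of_surjective`
(p228429; A118, good ordinary, all branches, flag `Kato-17.4-branch-split`). The `K`-reading is the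
one given in full in `ReducibleDivisibilityCyclotomicPrime` (A117) and, for the multiplicative local
type and the factor `I`, in `ReducibleMultiplicativeDivisibilityCyclotomicPrime` (this gen):
`ℚ(ζ_{p^∞}) = K_∞` for `K = ℚ(ζ_p)`, `X(E) = X(E/K_∞)` = the tree's `SelmerDualData` of a `K`-model
of `E_K` (`κ` cyclotomic, `χ_p(γ)·ζ = 1 + p`), `Λ(G) = ⊕_{i<p−1} Λ(Γ)e_i`, `e_0I = (T)e_0`,
`e_iI = Λ(Γ)e_i` (`i ≠ 0`), hence `char_{Λ(Γ)} X(E/K_∞) ∋ ∏_i L_p(E,ω^i,T)` (non-split) resp.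
`T·char_{Λ(Γ)} X(E/K_∞) ∋ ∏_i L_p(E,ω^i,T)` (split); branch `ω⁰` = THE `L` with
`IsMultPAdicLFunctionOf f p (−1) L` resp. `IsSplitMultPAdicLFunctionOf f p L`, even branches `0 < i` =
`padicLFunctionPlusBranchMult f α i`, odd = `padicLFunctionMinusBranchMult f α i`, `α = a_p = ∓1`;
periods `ϖ·Ω_E = Ω⁺_f`, `ϖ'·|Ω⁻(E)| = Ω⁻_f`, one factor per branch of the matching parity, units in
`u ∈ ℤ_pˣ`. The image hypothesis is spelled, as in every tree transcription of "the representation on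
the Tate module is surjective", as `∀ n, HasSurjectiveModNGaloisRep (p^n)` (equivalent by compactness
of the image; it implies (12.5.2)).

Hypotheses transcribed: `E = V` globally minimal over `ℚ`, `p ≠ 2`, multiplicative and not split
(first fact) resp. split (second fact) at `p`, `ρ̄_{E,p^n}` onto for every `n`, `K` cyclotomic `{p}`
over `ℚ`, `V'` any `K`-model of `E_K`, `κ` cyclotomic with topological generator `γ`,
`χ_p(γ)·ζ = 1 + p`, `f` the newform of `E`, `D` a dual datum of `Sel_{p^∞}(E/K_∞)`, the periods, and
`L` the `ω⁰`-branch. Conclusions: `X(E/K_∞)` is `Λ`-torsion and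
`u ϖ^{(p−1)/2}ϖ'^{(p−1)/2} · L · ∏_{0<i<p−1} B_i = ι g` (non-split) resp. `= ι(X·g)` (split) for some
`g ∈ char`, `u ∈ ℤ_pˣ`. Proposed flags: `Wu14-surj-attribution` (the surjective case is printed as
Thm. 3 + the attribution sentence and as the first case of the proof of Cor. 19) and
`Wu14-Thm16-branch-split` (+ `Wu14-I-augmentation-reading` for the split fact). What is NOT here:
global semistability (Cor. 19's own hypothesis — replaced, as in the siblings, by the surjectivity it
is used to produce), `p = 2`, the good case (A118), any proof.

Consumer: the BSD rank-≤1 residual cell (`b2b-bsdres`, additive-p4, line V19b): the (M)-rows of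
class X4 at `p ≥ 5` — `W ≅ V^{(p*)}` additive at `p` (Kodaira `I_n*`), `V` multiplicative at `p`,
`W[p]` (hence `V[p]`) irreducible with `ρ̄_{W,p}` onto; `ρ_{V,p^∞}` onto follows in the tree from
surj(p) of `W` by twist invariance and Serre's lemma (`p ≥ 5`). HONEST FRAMING: published inputs +
kernel composition only; no label changes; nothing here is "finishing BSD".
-/

set_option autoImplicit false

noncomputable section

open scoped Classical MatrixGroups ModularForm

open CongruenceSubgroup WeierstrassCurve Literature.NumberTheory.EllipticCurves
  Literature.NumberTheory.EllipticCurves.ModularForms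
  Literature.NumberTheory.GaloisRepresentations

namespace Literature.NumberTheory.EllipticCurves.Wuthrich2014

/-- **Kato's divisibility (Wuthrich 2014 Thm. 3, attribution "proven by Kato"; Cor. 19, first case of
the proof) at a NON-SPLIT MULTIPLICATIVE odd prime `p`, `ρ_{E,p^∞}` surjective, read over
`K = ℚ(ζ_p)`: `char_{Λ(Γ)} X(E/ℚ(ζ_{p^∞})) ∋ u · ∏_{i=0}^{p−2} L_p(E, ω^i, T)`.** As printed (Doc.
Math. 19 (2014), §1 p. 383): "We formulate it here for the full cyclotomic `ℤ_p^×`-extension.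
Theorem 3. Let `E` be an elliptic curve and `p` an odd prime of semi-stable reduction. […] Then the
characteristic series of the dual of the Selmer group over the cyclotomic extension [divides the ideal
generated by `L_p(E)`] […] This theorem was proven by Kato in the case that [the reduction is
ordinary and] the representation on the Tate module was surjective"; Cor. 19 (p. 398) "`char_Λ X(E)`,
or `I char_Λ X(E)` in the split multiplicative case, divides the ideal generated by `L_p(E)`", proof
p. 399, first case: "`ρ_p : G_ℚ → Aut(T_p E)` is surjective". `Λ = ℤ_p⟦Gal(ℚ(ζ_{p^∞})/ℚ)⟧` (§3 p. 390),
`X(E)` the dual of `lim_n Sel(E/ℚ(ζ_{p^n}))` (§5 p. 397; `Λ`-torsion: §5 and Greenberg LNM 1716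
Thm. 1.5 over the abelian base `ℚ(ζ_p)`), `L_p(E) ∈ Λ` (Cor. 18) the Néron-normalised ONE-term measure
(`α = a_p = −1`). Over `K = ℚ(ζ_p)`: `X(E) = X(E/K_∞)` = the tree's Iwasawa module of any `K`-model
`V'` of `E_K` (`κ` cyclotomic, `χ_p(γ)·ζ = 1 + p`); `Λ(G) = ⊕_{i<p−1} Λ(Γ)e_i` gives
`char_{Λ(Γ)} X(E/K_∞) ∋ ∏_{i<p−1} L_p(E,ω^i,T)` (reading of the accepted siblings A105 / A118, flags
`Wu14-surj-attribution`, `…-branch-split`): branch `ω⁰` = THE `L` with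
`IsMultPAdicLFunctionOf f p (−1) L`, even `0 < i` = `padicLFunctionPlusBranchMult f (−1) i`, odd =
`padicLFunctionMinusBranchMult f (−1) i`; periods `ϖ·Ω_E = Ω⁺_f`, `ϖ'·|Ω⁻(E)| = Ω⁻_f`, units in
`u ∈ ℤ_pˣ`. Hypotheses: `V` globally minimal, `p ≠ 2`, multiplicative not split at `p`, `ρ̄_{V,p^n}`
onto for all `n`, `K`, `V'`, `κ`, `γ`, `ζ`, `f`, `D`, `ϖ`, `ϖ'`, `L` as displayed. Conclusion:
`D.IsTorsion ∧ ∃ g ∈ char, ∃ u, ι g = C(u ϖ^{(p−1)/2} ϖ'^{(p−1)/2}) · (L · ∏_{0<i<p−1} B_i)`. Named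
fact; nothing asserted.
[cite: Wuthrich2014, §1 Thm. 3 (p. 383), Cor. 19 and its proof (pp. 398–399), §5 (p. 397), §3 (p. 390), §3.2 (p. 394), Cor. 18 (p. 398)]
[cite: GreenbergLNM1716, Thm. 1.5 (PDF p. 61)] [cite: Kato2004Asterisque, Thm. 12.5 (4), (12.5.2) (p. 222)]
[cite: MazurTateTeitelbaum1986Invent, §I.10, §I.13] -/
def kato_charIdeal_dvd_nonsplitMultiplicative_cyclotomicPrime_of_surjective : Prop :=
  ∀ (p : ℕ) [Fact p.Prime] (V : WeierstrassCurve ℚ) [V.IsElliptic] [V.IsGloballyMinimal]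
    (K : Type) [Field K] [NumberField K] [IsCyclotomicExtension {p} ℚ K]
    (V' : WeierstrassCurve K) [V'.IsElliptic]
    {κ : ZpExtension K p} {γ : Field.absoluteGaloisGroup K} {N : ℕ} [NeZero N]
    {f : CuspForm (Gamma0 N) 2},
    p ≠ 2 → V.HasMultiplicativeReductionAtPrime p → ¬ V.HasSplitMultiplicativeReductionAtPrime p →
    (∀ n : ℕ, V.HasSurjectiveModNGaloisRep (p ^ n)) →
    (∃ C : VariableChange K, C • V.baseChange K = V') →
    κ.IsCyclotomic → κ.IsTopGenerator γ →
    (∃ ζ : ℤ_[p]ˣ, IsOfFinOrder ζ ∧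
      ((GaloisRep.cyclotomicCharacter K p γ * ζ : ℤ_[p]ˣ) : ℤ_[p]) =
        (cyclotomicGenerator p : ℤ_[p])) →
    IsNewformOf V f →
    ∀ (D : V'.SelmerDualData κ γ) (ϖ ϖ' : ℚ),
      (ϖ : ℝ) * V.realPeriodRat = plusPeriod f →
      (ϖ' : ℝ) * V.imaginaryPeriodRat = minusPeriod f →
    ∀ (L : PowerSeries ℚ_[p]), IsMultPAdicLFunctionOf f p (-1) L →
      D.IsTorsion ∧
      ∃ g ∈ D.charIdeal, ∃ u : ℤ_[p]ˣ,
        iwasawaToPowerSeries p g =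
          PowerSeries.C (((u : ℤ_[p]) : ℚ_[p]) * (ϖ : ℚ_[p]) ^ (p / 2) * (ϖ' : ℚ_[p]) ^ (p / 2)) *
            (L * ∏ i ∈ Finset.Ico 1 (p - 1),
              (if Even i then padicLFunctionPlusBranchMult f (-1 : ℚ_[p]) i
                else padicLFunctionMinusBranchMult f (-1 : ℚ_[p]) i))

/-- **Kato's divisibility (Wuthrich 2014 Thm. 3, attribution "proven by Kato"; Cor. 19 "or
`I char_Λ X(E)` in the split multiplicative case", first case of the proof) at a SPLIT MULTIPLICATIVE
odd prime `p`, `ρ_{E,p^∞}` surjective, read over `K = ℚ(ζ_p)`: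
`T · char_{Λ(Γ)} X(E/ℚ(ζ_{p^∞})) ∋ u · ∏_{i=0}^{p−2} L_p(E, ω^i, T)`.** As printed (Doc. Math. 19
(2014), §1 p. 383): "Theorem 3. Let `E` be an elliptic curve and `p` an odd prime of semi-stable
reduction. […] In the case when `E` has split multiplicative reduction, one can strengthen this a
bit, see theorem 16. This theorem was proven by Kato in the case that […] the representation on the
Tate module was surjective"; Thm. 16 (p. 397): "If the reduction of `E` is split multiplicative at
`p`, then `I · char_Λ X(E)` divides the ideal generated by `L_p(E)`, where `I` is the kernel of the
homomorphism `Λ → ℤ_p` that sends all elements of [the group] to `1`"; Cor. 19 (p. 398) "or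
`I char_Λ X(E)` in the split multiplicative case", proof p. 399, first case ("`ρ_p` … is
surjective"). `Λ`, `X(E)` (`Λ`-torsion: §5, "see [Kobayashi 2006] for the split multiplicative
case"; Greenberg Thm. 1.5), `L_p(E) ∈ Λ` (Cor. 18; ONE-term measure, `α = a_p = +1`) as in the
non-split twin. Over `K = ℚ(ζ_p)`: `X(E) = X(E/K_∞)`; `Λ(G) = ⊕_{i<p−1} Λ(Γ)e_i` with `e_0I = (T)e_0`,
`e_iI = Λ(Γ)e_i` (`i ≠ 0`) turns `L_p(E) ∈ I·char X(E)` into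
`T·char_{Λ(Γ)} X(E/K_∞) ∋ ∏_{i<p−1} L_p(E,ω^i,T)` (the reading of the accepted `p = 3` sibling A108,
flags `Wu14-surj-attribution`, `Wu14-Thm16-p3-branch-split`, `Wu14-I-augmentation-reading`, with
`p − 1` components): branch `ω⁰` = THE `L` with `IsSplitMultPAdicLFunctionOf f p L` (`L(0) = 0`),
even `0 < i` = `padicLFunctionPlusBranchMult f 1 i`, odd = `padicLFunctionMinusBranchMult f 1 i`;
periods `ϖ·Ω_E = Ω⁺_f`, `ϖ'·|Ω⁻(E)| = Ω⁻_f`; units in `u ∈ ℤ_pˣ`. Hypotheses: `V` globally minimal,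
`p ≠ 2`, SPLIT multiplicative at `p`, `ρ̄_{V,p^n}` onto for all `n`, `K`, `V'`, `κ`, `γ`, `ζ`, `f`,
`D`, `ϖ`, `ϖ'`, `L` as displayed. Conclusion:
`D.IsTorsion ∧ ∃ g ∈ char, ∃ u, ι(X · g) = C(u ϖ^{(p−1)/2} ϖ'^{(p−1)/2}) · (L · ∏_{0<i<p−1} B_i)`.
Named fact; nothing asserted.
[cite: Wuthrich2014, §1 Thm. 3 (p. 383), Thm. 16 (p. 397), Cor. 19 and its proof (pp. 398–399), §5 (p. 397), §3 (p. 390), §3.2 (p. 394), Cor. 18 (p. 398)]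
[cite: GreenbergLNM1716, Thm. 1.5 (PDF p. 61)] [cite: Kato2004Asterisque, Thm. 12.5 (4), (12.5.2) (p. 222)]
[cite: MazurTateTeitelbaum1986Invent, §I.10, §I.13] -/
def kato_charIdeal_dvd_splitMultiplicative_cyclotomicPrime_of_surjective : Prop :=
  ∀ (p : ℕ) [Fact p.Prime] (V : WeierstrassCurve ℚ) [V.IsElliptic] [V.IsGloballyMinimal]
    (K : Type) [Field K] [NumberField K] [IsCyclotomicExtension {p} ℚ K]
    (V' : WeierstrassCurve K) [V'.IsElliptic]
    {κ : ZpExtension K p} {γ : Field.absoluteGaloisGroup K} {N : ℕ} [NeZero N]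
    {f : CuspForm (Gamma0 N) 2},
    p ≠ 2 → V.HasSplitMultiplicativeReductionAtPrime p →
    (∀ n : ℕ, V.HasSurjectiveModNGaloisRep (p ^ n)) →
    (∃ C : VariableChange K, C • V.baseChange K = V') →
    κ.IsCyclotomic → κ.IsTopGenerator γ →
    (∃ ζ : ℤ_[p]ˣ, IsOfFinOrder ζ ∧
      ((GaloisRep.cyclotomicCharacter K p γ * ζ : ℤ_[p]ˣ) : ℤ_[p]) =
        (cyclotomicGenerator p : ℤ_[p])) →
    IsNewformOf V f →
    ∀ (D : V'.SelmerDualData κ γ) (ϖ ϖ' : ℚ),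
      (ϖ : ℝ) * V.realPeriodRat = plusPeriod f →
      (ϖ' : ℝ) * V.imaginaryPeriodRat = minusPeriod f →
    ∀ (L : PowerSeries ℚ_[p]), IsSplitMultPAdicLFunctionOf f p L →
      D.IsTorsion ∧
      ∃ g ∈ D.charIdeal, ∃ u : ℤ_[p]ˣ,
        iwasawaToPowerSeries p (PowerSeries.X * g) =
          PowerSeries.C (((u : ℤ_[p]) : ℚ_[p]) * (ϖ : ℚ_[p]) ^ (p / 2) * (ϖ' : ℚ_[p]) ^ (p / 2)) *
            (L * ∏ i ∈ Finset.Ico 1 (p - 1),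
              (if Even i then padicLFunctionPlusBranchMult f (1 : ℚ_[p]) i
                else padicLFunctionMinusBranchMult f (1 : ℚ_[p]) i))

end Literature.NumberTheory.EllipticCurves.Wuthrich2014

end
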